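import Summits.BirchSwinnertonDyer.BirchSwinnertonDyer.Theorems.TwoAdicConverseFullTwoTorsionRamified
import HarnessLib

/-!
# Route `TwoAdicConverse` (rung S3), crux `OrdLambdaHalfAtTwo` (item 19556): on a full-`2`-torsion curve the ramified point of
# order `2` is UNIQUE — so Greenberg's Prop-5.14 habitat (CF) and his Prop-5.13 locus are DISJOINT and, at a good `2`, COMPLEMENTARY

Cell `bsd-2adic` (run/shared/lean/pub/bsd-2adic/), seat `bsd-2adic-conv-1` (GEN 5); sequel of
`TwoAdicConverseFullTwoTorsionRamified` (p462024: at a GOOD `2` at least one of the three rational points of order `2` is ramified).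
THEOREMS ONLY — no named fact, no axiom, no definition; UNCONDITIONAL. HONEST FRAMING: habitat structure for the `stub_nonsurj`
side of item 19556 and a CONSISTENCY CERTIFICATE for the cell's two PRINT binders `h514` (Greenberg 5.14: `μ = 0`) and `h513`
(Greenberg 5.13, `m = 1`: `μ ≥ 1`) on the full-`2`-torsion class — were both hypotheses satisfiable on one curve, the two named
facts would jointly give `X` torsion with `μ = 0` and `μ ≥ 1`. Nothing about `λ`; 19556 / Kato's IMC at `2` stay OPEN; BSD is
not proved by any of this. PARTITION (D-0054): none — RANK axis (S3); companion formula cell X5@2 good-ord (B1·O1).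

**Statements** (`W/ℚ` globally minimal — integrality of `b₄, b₆` is all that is used — with three rational points of order `2`
of pairwise distinct abscissae; "ramified" = `v₂(x) < 0`, "odd" = least real root, Greenberg LNM 1716 §5).
* `two_le_norm_padic_of_twoTorsionRamifiedAtTwo` — a ramified abscissa has `‖x‖₂ ≥ 2`.
* `eq_or_eq_or_eq_of_hasRationalTwoTorsionX` — every rational point of order `2` has abscissa among the three (factorisation
  of the `2`-division cubic, p462024 §1).
* **`not_twoTorsionRamifiedAtTwo_and`** — AT MOST ONE of the three abscissae is ramified, for ANY globally minimal curve (no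
  reduction hypothesis). Proof (`2`-adic sizes in Vieta): if `‖p‖₂, ‖q‖₂ ≥ 2` then `4pqr = −b₆` forces `‖r‖₂ ≤ 1`, so in
  `e₂ = pq + r(p+q) = b₄/2` the term `pq` dominates strictly (`‖r(p+q)‖ ≤ max(‖p‖,‖q‖) < ‖p‖‖q‖`), giving
  `4 ≤ ‖pq‖₂ = ‖b₄/2‖₂ ≤ 2`. (This is the elementary shadow of `E₁(ℚ₂)[2] ⊂ E₁(ℚ₂)/E₂(ℚ₂) ≅ 𝔽₂`, Silverman AEC IV.3.2, VII.2.2.)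
* `twoTorsionOdd_unique` — at most one abscissa is odd (two odd ones are `≤` each other).
* **`existsUnique_twoTorsionRamifiedAtTwo_of_fullTwoTorsion`** — at a GOOD `2`: EXACTLY ONE rational point of order `2` is ramified
  (existence = p462024).
* **`not_prop514_and_prop513_hypothesis_of_fullTwoTorsion`** — the hypotheses of Prop. 5.14 (CF binder `hΦ`: a point ramified-XOR-odd)
  and of Prop. 5.13 (`m = 1`: a point ramified-AND-odd) are never both satisfied on a full-`2`-torsion globally minimal curve;
  with p462024's `prop514_or_prop513_hypothesis_of_fullTwoTorsion`: at a good `2` EXACTLY ONE of them holds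
  (`prop514_xor_prop513_hypothesis_of_fullTwoTorsion`) — the class is the DISJOINT union CF ⊔ (5.13-locus), read off one
  comparison of rationals (is the unique ramified abscissa the least one?).

References: R. Greenberg, LNM 1716 (1999), §5 pp. 120–122, pp. 173–177 [GreenbergLNM1716]; J. H. Silverman, *AEC*, GTM 106 (2009),
IV.3.2, VII.2.2 (the filtration `E₁ ⊃ E₂`), III.2.3 [SilvermanAEC2009].
-/

set_option linter.dupNamespace false
set_option autoImplicit false

noncomputable section

open scoped Classical
open WeierstrassCurve Literature.NumberTheory.EllipticCurves Literature.NumberTheory.EllipticCurves.Greenberg1999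

namespace Summit.BirchSwinnertonDyer.BirchSwinnertonDyer.Theorems.TwoAdicTwistConverse

/-! ## §1. Sizes -/

/-- A ramified abscissa (`v₂(x) < 0`) has `‖x‖₂ ≥ 2`. [folklore] -/
theorem two_le_norm_padic_of_twoTorsionRamifiedAtTwo {x : ℚ} (h : TwoTorsionRamifiedAtTwo x) :
    (2 : ℝ) ≤ ‖(x : ℚ_[2])‖ := by
  rw [TwoTorsionRamifiedAtTwo] at h
  have hx : x ≠ 0 := by
    rintro rfl
    simp at h
  rw [Padic.eq_padicNorm, padicNorm.eq_zpow_of_nonzero hx]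
  push_cast
  calc (2 : ℝ) = 2 ^ (1 : ℤ) := by norm_num
    _ ≤ 2 ^ (-padicValRat 2 x) := zpow_le_zpow_right₀ (by norm_num) (by linarith)

/-- `‖2‖₂ = 2⁻¹`. [folklore] -/
theorem norm_two_padic_two : ‖(2 : ℚ_[2])‖ = (2 : ℝ)⁻¹ := by
  have h := Padic.norm_p (p := 2)
  exact_mod_cast h

variable (W : WeierstrassCurve ℚ)

/-- `b₄` of a globally minimal `W/ℚ` is the integer `b₄` of its integral model. [cite: SilvermanAEC2009, VIII.8 (global minimal model)] -/
theorem b₄_eq_cast_integralModelInt [W.IsGloballyMinimal] : W.b₄ = ((integralModelInt W).b₄ : ℚ) := by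
  have h := congrArg WeierstrassCurve.b₄ (map_integralModelInt W)
  rw [WeierstrassCurve.map_b₄, eq_intCast] at h
  exact h.symm

/-! ## §2. Every rational point of order `2` is one of the three; at most one is ramified; at most one is odd -/

/-- With three rational points of order `2` of distinct abscissae `x₁, x₂, x₃`, EVERY rational point of order `2` has abscissa
`x₁`, `x₂` or `x₃` (its abscissa is a root of `4X³ + b₂X² + 2b₄X + b₆ = 4(X − x₁)(X − x₂)(X − x₃)`). [cite: SilvermanAEC2009, III.2.3 (ψ₂)] -/
theorem eq_or_eq_or_eq_of_hasRationalTwoTorsionX {x₁ x₂ x₃ a : ℚ} (h12 : x₁ ≠ x₂) (h13 : x₁ ≠ x₃) (h23 : x₂ ≠ x₃)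
    (h₁ : HasRationalTwoTorsionX W x₁) (h₂ : HasRationalTwoTorsionX W x₂) (h₃ : HasRationalTwoTorsionX W x₃)
    (ha : HasRationalTwoTorsionX W a) : a = x₁ ∨ a = x₂ ∨ a = x₃ := by
  obtain ⟨y₁, hP₁, ht₁⟩ := h₁
  obtain ⟨y₂, hP₂, ht₂⟩ := h₂
  obtain ⟨y₃, hP₃, ht₃⟩ := h₃
  obtain ⟨ya, hPa, hta⟩ := ha
  have c₁ := fourXCubed_add_eq_zero_of_twoTorsion hP₁ ht₁
  have c₂ := fourXCubed_add_eq_zero_of_twoTorsion hP₂ ht₂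
  have c₃ := fourXCubed_add_eq_zero_of_twoTorsion hP₃ ht₃
  have ca := fourXCubed_add_eq_zero_of_twoTorsion hPa hta
  rw [fourXCubed_eq_prod_of_three_roots c₁ c₂ c₃ h12 h13 h23 a] at ca
  rcases mul_eq_zero.mp ca with h | h
  · rcases mul_eq_zero.mp h with h' | h'
    · rcases mul_eq_zero.mp h' with h'' | h''
      · norm_num at h''
      · exact Or.inl (sub_eq_zero.mp h'')
    · exact Or.inr (Or.inl (sub_eq_zero.mp h'))
  · exact Or.inr (Or.inr (sub_eq_zero.mp h))

/-- **At most one of the three rational points of order `2` is ramified at `2`** on a globally minimal `W/ℚ` (no reduction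
hypothesis): if `p ≠ q` were both ramified (`‖p‖₂, ‖q‖₂ ≥ 2`), then `4pqr = −b₆ ∈ ℤ` gives `‖r‖₂ ≤ 1`, and in
`2(pq + r(p + q)) = b₄ ∈ ℤ` the term `pq` dominates: `4 ≤ ‖pq‖₂ = ‖pq + r(p+q)‖₂ = ‖b₄‖₂·2 ≤ 2`. (The group-theoretic reason:
`E₁(ℚ₂)[2]` embeds in `E₁(ℚ₂)/E₂(ℚ₂) ≅ 𝔽₂`.) [cite: SilvermanAEC2009, IV.3.2 and VII.2.2] [cite: GreenbergLNM1716, §5 p. 170 (C₂[2])] -/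
theorem not_twoTorsionRamifiedAtTwo_and [W.IsGloballyMinimal] {p q r : ℚ} (hpq : p ≠ q) (hpr : p ≠ r) (hqr : q ≠ r)
    (hp : HasRationalTwoTorsionX W p) (hq : HasRationalTwoTorsionX W q) (hr : HasRationalTwoTorsionX W r) :
    ¬ (TwoTorsionRamifiedAtTwo p ∧ TwoTorsionRamifiedAtTwo q) := by
  rintro ⟨hRp, hRq⟩
  obtain ⟨yp, hPp, htp⟩ := hp
  obtain ⟨yq, hPq, htq⟩ := hq
  obtain ⟨yr, hPr, htr⟩ := hr
  have cp := fourXCubed_add_eq_zero_of_twoTorsion hPp htp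
  have cq := fourXCubed_add_eq_zero_of_twoTorsion hPq htq
  have cr := fourXCubed_add_eq_zero_of_twoTorsion hPr htr
  obtain ⟨-, he₂, he₃⟩ := vieta_of_three_twoTorsion_roots cp cq cr hpq hpr hqr
  rw [b₄_eq_cast_integralModelInt W] at he₂
  rw [b₆_eq_cast_integralModelInt W] at he₃
  set A := integralModelInt W with hA
  have Np := two_le_norm_padic_of_twoTorsionRamifiedAtTwo hRp
  have Nq := two_le_norm_padic_of_twoTorsionRamifiedAtTwo hRq
  have hb₄ : ‖((A.b₄ : ℤ) : ℚ_[2])‖ ≤ 1 := Padic.norm_int_le_one _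
  have hb₆ : ‖((A.b₆ : ℤ) : ℚ_[2])‖ ≤ 1 := Padic.norm_int_le_one _
  -- Vieta read in `ℚ₂`
  have he₃' : ((p : ℚ_[2]) * q) * r = -4⁻¹ * ((A.b₆ : ℤ) : ℚ_[2]) := by
    have h := congrArg (fun t : ℚ => (t : ℚ_[2])) he₃
    push_cast at h
    linear_combination (4 : ℚ_[2])⁻¹ * h
  have he₂' : (p : ℚ_[2]) * q + r * (p + q) = 2⁻¹ * ((A.b₄ : ℤ) : ℚ_[2]) := by
    have h := congrArg (fun t : ℚ => (t : ℚ_[2])) he₂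
    push_cast at h
    linear_combination (4 : ℚ_[2])⁻¹ * h
  have h4inv : ‖(4 : ℚ_[2])⁻¹‖ = 4 := by
    rw [norm_inv, norm_four_padic_two]
    norm_num
  have h2inv : ‖(2 : ℚ_[2])⁻¹‖ = 2 := by
    rw [norm_inv, norm_two_padic_two, inv_inv]
  -- `‖r‖ ≤ 1`
  have hpqr : ‖(p : ℚ_[2])‖ * ‖(q : ℚ_[2])‖ * ‖(r : ℚ_[2])‖ ≤ 4 := by
    have h := congrArg norm he₃'
    rw [norm_mul, norm_mul, norm_mul, norm_neg, h4inv] at h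
    rw [h]
    calc 4 * ‖((A.b₆ : ℤ) : ℚ_[2])‖ ≤ 4 * 1 := by gcongr
      _ = 4 := mul_one _
  have hr1 : ‖(r : ℚ_[2])‖ ≤ 1 := by
    have h4 : (4 : ℝ) ≤ ‖(p : ℚ_[2])‖ * ‖(q : ℚ_[2])‖ := by nlinarith [norm_nonneg (q : ℚ_[2])]
    by_contra hlt
    rw [not_le] at hlt
    have : (4 : ℝ) * 1 < ‖(p : ℚ_[2])‖ * ‖(q : ℚ_[2])‖ * ‖(r : ℚ_[2])‖ := by
      calc (4 : ℝ) * 1 ≤ ‖(p : ℚ_[2])‖ * ‖(q : ℚ_[2])‖ * 1 := by gcongr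
        _ < ‖(p : ℚ_[2])‖ * ‖(q : ℚ_[2])‖ * ‖(r : ℚ_[2])‖ := by gcongr
    linarith
  -- `pq` dominates `r(p+q)`
  have hlt : ‖(r : ℚ_[2]) * (p + q)‖ < ‖(p : ℚ_[2]) * q‖ := by
    rw [norm_mul, norm_mul]
    have hsum : ‖(p : ℚ_[2]) + q‖ ≤ max ‖(p : ℚ_[2])‖ ‖(q : ℚ_[2])‖ := Padic.nonarchimedean _ _
    have hmax : max ‖(p : ℚ_[2])‖ ‖(q : ℚ_[2])‖ < ‖(p : ℚ_[2])‖ * ‖(q : ℚ_[2])‖ := by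
      rcases le_total ‖(p : ℚ_[2])‖ ‖(q : ℚ_[2])‖ with h | h
      · rw [max_eq_right h]; nlinarith
      · rw [max_eq_left h]; nlinarith
    calc ‖(r : ℚ_[2])‖ * ‖(p : ℚ_[2]) + q‖ ≤ 1 * max ‖(p : ℚ_[2])‖ ‖(q : ℚ_[2])‖ :=
          mul_le_mul hr1 hsum (norm_nonneg _) zero_le_one
      _ < ‖(p : ℚ_[2])‖ * ‖(q : ℚ_[2])‖ := by rw [one_mul]; exact hmax
  have heq : ‖(p : ℚ_[2]) * q + r * (p + q)‖ = ‖(p : ℚ_[2]) * q‖ := by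
    rw [Padic.add_eq_max_of_ne (ne_of_gt hlt), max_eq_left hlt.le]
  -- `4 ≤ ‖pq‖ = ‖b₄‖·2 ≤ 2`
  have hge : (4 : ℝ) ≤ ‖(p : ℚ_[2]) * q‖ := by
    rw [norm_mul]; nlinarith [norm_nonneg (q : ℚ_[2])]
  have hle : ‖(p : ℚ_[2]) * q‖ ≤ 2 := by
    rw [← heq, he₂', norm_mul, h2inv]
    calc 2 * ‖((A.b₄ : ℤ) : ℚ_[2])‖ ≤ 2 * 1 := by gcongr
      _ = 2 := mul_one _
  linarith

/-- At most one abscissa is odd: two odd abscissae of rational points of order `2` coincide (each is `≤` the other).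
[cite: GreenbergLNM1716, §5 Remark (chunk p0174: the point of E(ℝ)[2] with minimal x-coordinate)] -/
theorem twoTorsionOdd_unique {a c : ℚ} (ha : HasRationalTwoTorsionX W a) (hc : HasRationalTwoTorsionX W c)
    (hoa : TwoTorsionOdd W a) (hoc : TwoTorsionOdd W c) : a = c := by
  obtain ⟨ya, hPa, hta⟩ := ha
  obtain ⟨yc, hPc, htc⟩ := hc
  have h₁ : (a : ℝ) ≤ c := hoa c (fourXCubed_add_eq_zero_of_twoTorsion_real hPc htc)
  have h₂ : (c : ℝ) ≤ a := hoc a (fourXCubed_add_eq_zero_of_twoTorsion_real hPa hta)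
  exact_mod_cast le_antisymm h₁ h₂

/-! ## §3. Exactly one ramified point at a good `2`; the 5.14 / 5.13 hypotheses are complementary -/

section Exact

variable [W.IsGloballyMinimal]

/-- Two DISTINCT ramified abscissae among the rational points of order `2` cannot exist (given a full rational `2`-torsion
`x₁, x₂, x₃`): both are among the `xᵢ`, and `not_twoTorsionRamifiedAtTwo_and` applies to them and the third abscissa.
[cite: SilvermanAEC2009, VII.2.2] -/
theorem eq_of_twoTorsionRamifiedAtTwo_of_fullTwoTorsion {x₁ x₂ x₃ : ℚ} (h12 : x₁ ≠ x₂) (h13 : x₁ ≠ x₃) (h23 : x₂ ≠ x₃)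
    (h₁ : HasRationalTwoTorsionX W x₁) (h₂ : HasRationalTwoTorsionX W x₂) (h₃ : HasRationalTwoTorsionX W x₃)
    {a c : ℚ} (ha : HasRationalTwoTorsionX W a) (hRa : TwoTorsionRamifiedAtTwo a)
    (hc : HasRationalTwoTorsionX W c) (hRc : TwoTorsionRamifiedAtTwo c) : a = c := by
  by_contra hac
  rcases eq_or_eq_or_eq_of_hasRationalTwoTorsionX W h12 h13 h23 h₁ h₂ h₃ ha with rfl | rfl | rfl <;>
    rcases eq_or_eq_or_eq_of_hasRationalTwoTorsionX W h12 h13 h23 h₁ h₂ h₃ hc with rfl | rfl | rfl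
  · exact hac rfl
  · exact not_twoTorsionRamifiedAtTwo_and W h12 h13 h23 h₁ h₂ h₃ ⟨hRa, hRc⟩
  · exact not_twoTorsionRamifiedAtTwo_and W h13 h12 h23.symm h₁ h₃ h₂ ⟨hRa, hRc⟩
  · exact not_twoTorsionRamifiedAtTwo_and W h12.symm h23 h13 h₂ h₁ h₃ ⟨hRa, hRc⟩
  · exact hac rfl
  · exact not_twoTorsionRamifiedAtTwo_and W h23 h12.symm h13.symm h₂ h₃ h₁ ⟨hRa, hRc⟩
  · exact not_twoTorsionRamifiedAtTwo_and W h13.symm h23.symm h12 h₃ h₁ h₂ ⟨hRa, hRc⟩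
  · exact not_twoTorsionRamifiedAtTwo_and W h23.symm h13.symm h12.symm h₃ h₂ h₁ ⟨hRa, hRc⟩
  · exact hac rfl

/-- **Exactly one of the three rational points of order `2` is ramified at `2`** on a globally minimal curve with good reduction
at `2` and full rational `2`-torsion (existence: p462024 `exists_twoTorsionRamifiedAtTwo_of_fullTwoTorsion`; uniqueness:
`not_twoTorsionRamifiedAtTwo_and`). [cite: GreenbergLNM1716, §5 p. 170 and pp. 173–177] [cite: SilvermanAEC2009, VII.2.2] -/
theorem existsUnique_twoTorsionRamifiedAtTwo_of_fullTwoTorsion (hgood : W.HasGoodReductionAtPrime 2) {x₁ x₂ x₃ : ℚ}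
    (h12 : x₁ ≠ x₂) (h13 : x₁ ≠ x₃) (h23 : x₂ ≠ x₃) (h₁ : HasRationalTwoTorsionX W x₁)
    (h₂ : HasRationalTwoTorsionX W x₂) (h₃ : HasRationalTwoTorsionX W x₃) :
    ∃! x : ℚ, HasRationalTwoTorsionX W x ∧ TwoTorsionRamifiedAtTwo x := by
  rcases exists_twoTorsionRamifiedAtTwo_of_fullTwoTorsion W hgood h12 h13 h23 h₁ h₂ h₃ with h | h | h
  · exact ⟨x₁, ⟨h₁, h⟩, fun c hc =>
      eq_of_twoTorsionRamifiedAtTwo_of_fullTwoTorsion W h12 h13 h23 h₁ h₂ h₃ hc.1 hc.2 h₁ h⟩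
  · exact ⟨x₂, ⟨h₂, h⟩, fun c hc =>
      eq_of_twoTorsionRamifiedAtTwo_of_fullTwoTorsion W h12 h13 h23 h₁ h₂ h₃ hc.1 hc.2 h₂ h⟩
  · exact ⟨x₃, ⟨h₃, h⟩, fun c hc =>
      eq_of_twoTorsionRamifiedAtTwo_of_fullTwoTorsion W h12 h13 h23 h₁ h₂ h₃ hc.1 hc.2 h₃ h⟩

/-- **The hypotheses of Greenberg's Prop. 5.14 and Prop. 5.13 (`m = 1`) are DISJOINT on the full-`2`-torsion class** (any globally
minimal `W/ℚ` with three rational points of order `2` of distinct abscissae; no reduction hypothesis): no curve carries both a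
rational point of order `2` that is ramified-XOR-odd and one that is ramified-AND-odd (two ramified points, or two odd points,
coincide). So the cell's PRINT binders `h514` (`μ = 0`) and `h513` (`μ ≥ 1`) are never invoked on the same curve of this class.
[cite: GreenbergLNM1716, §5 Props. 5.13–5.14 (pp. 120–121)] -/
theorem not_prop514_and_prop513_hypothesis_of_fullTwoTorsion
    (hfull : ∃ x₁ x₂ x₃ : ℚ, x₁ ≠ x₂ ∧ x₁ ≠ x₃ ∧ x₂ ≠ x₃ ∧ HasRationalTwoTorsionX W x₁ ∧
      HasRationalTwoTorsionX W x₂ ∧ HasRationalTwoTorsionX W x₃) :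
    ¬ ((∃ x y : ℚ, W.toAffine.Equation x y ∧ 2 * y + W.a₁ * x + W.a₃ = 0 ∧
          ((TwoTorsionRamifiedAtTwo x ∧ ¬ TwoTorsionOdd W x) ∨ (TwoTorsionOdd W x ∧ ¬ TwoTorsionRamifiedAtTwo x))) ∧
        (∃ x y : ℚ, W.toAffine.Equation x y ∧ 2 * y + W.a₁ * x + W.a₃ = 0 ∧
          TwoTorsionRamifiedAtTwo x ∧ TwoTorsionOdd W x)) := by
  obtain ⟨x₁, x₂, x₃, h12, h13, h23, h₁, h₂, h₃⟩ := hfull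
  rintro ⟨⟨c, yc, hPc, htc, hΦ⟩, ⟨a, ya, hPa, hta, hRa, hOa⟩⟩
  have ha : HasRationalTwoTorsionX W a := ⟨ya, hPa, hta⟩
  have hc : HasRationalTwoTorsionX W c := ⟨yc, hPc, htc⟩
  rcases hΦ with ⟨hRc, hNOc⟩ | ⟨hOc, hNRc⟩
  · -- `a` and `c` both ramified ⟹ `a = c`, but `a` is odd and `c` is not
    exact hNOc ((eq_of_twoTorsionRamifiedAtTwo_of_fullTwoTorsion W h12 h13 h23 h₁ h₂ h₃ ha hRa hc hRc) ▸ hOa)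
  · -- `a` and `c` both odd ⟹ `a = c`, but `a` is ramified and `c` is not
    exact hNRc ((twoTorsionOdd_unique W ha hc hOa hOc) ▸ hRa)

/-- **At a good `2` EXACTLY ONE of the two hypotheses holds** (p462024 `prop514_or_prop513_hypothesis_of_fullTwoTorsion` +
`not_prop514_and_prop513_hypothesis_of_fullTwoTorsion`): the full-`2`-torsion good-at-`2` class is the DISJOINT union of the CF
habitat (Prop. 5.14's hypothesis) and the Prop-5.13 locus. [cite: GreenbergLNM1716, §5 Props. 5.13–5.14 (pp. 120–121)] -/
theorem prop514_xor_prop513_hypothesis_of_fullTwoTorsion (hgood : W.HasGoodReductionAtPrime 2)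
    (hfull : ∃ x₁ x₂ x₃ : ℚ, x₁ ≠ x₂ ∧ x₁ ≠ x₃ ∧ x₂ ≠ x₃ ∧ HasRationalTwoTorsionX W x₁ ∧
      HasRationalTwoTorsionX W x₂ ∧ HasRationalTwoTorsionX W x₃) :
    Xor (∃ x y : ℚ, W.toAffine.Equation x y ∧ 2 * y + W.a₁ * x + W.a₃ = 0 ∧
          ((TwoTorsionRamifiedAtTwo x ∧ ¬ TwoTorsionOdd W x) ∨ (TwoTorsionOdd W x ∧ ¬ TwoTorsionRamifiedAtTwo x)))
      (∃ x y : ℚ, W.toAffine.Equation x y ∧ 2 * y + W.a₁ * x + W.a₃ = 0 ∧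
          TwoTorsionRamifiedAtTwo x ∧ TwoTorsionOdd W x) := by
  have hnot := not_prop514_and_prop513_hypothesis_of_fullTwoTorsion W hfull
  rcases prop514_or_prop513_hypothesis_of_fullTwoTorsion W hgood hfull with h | h
  · exact Or.inl ⟨h, fun h' => hnot ⟨h, h'⟩⟩
  · exact Or.inr ⟨h, fun h' => hnot ⟨h', h⟩⟩

end Exact

end Summit.BirchSwinnertonDyer.BirchSwinnertonDyer.Theorems.TwoAdicTwistConverse

end
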